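import Summits.CriticalPhenomena.PercolationContinuityZ3.Theorems.PercNearOneGluingNoHeavyConstsObsConstSharp
import Literature.Probability.Percolation.TwoClusterConditionalAssociation
import Literature.Probability.Percolation.KozmaNitzanSeparatingTriple
import HarnessLib

/-!
# Single-edge reduction for the observer constant of MDL(X): an admissible constant of the pair-deleted graph that is
# at most the single-pair value `p⋆` is admissible (PAPER-2 track (ii): constants of the CSH family)

builds on p205010 (kernel theorem, internal audit signed; external expert review pending).  Support file (`--supports
stmt-CriticalPhenomena-4575`), seat `prim-consts-2`; rows A6/A11 of `run/shared/lean/prim/consts/CONSTANTS.md`.  No definitions, no named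
facts, no sorries.  (Two small lemmas of `…ConstsSingleEdgeValue` / `…ConstsMDLXJointImpliesMDLX` are re-proved privately so that this
file elaborates against the current farm snapshot.)

SETTING.  `μ = prodBernoulli w`, owner `x`, avoided set `Y ∌ x`, observers `o` and `v ≠ x`, `v ∉ Y`; `e = s(x,v)`; `w₀` = `w` with the pair `e`
switched off (`μ₀`); `D = {x ↮ Y}`, `D₁ = {x ↮ Y} ∩ {v ↮ Y}`.  A constant `λ` is ADMISSIBLE (for `w`) when the level-0 inequality of the
conditioned slack hierarchy `covD w x Y f o − λ · covD w x Y f v ≥ 0` holds for every monotone `f` (MDL(X) says the tree's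
`p = P(o ∈ C_v | v ↮ {x} ∪ Y)` is admissible; `Consts.singleEdge_not_improvable` says every admissible `λ` is `≤ p⋆`, the single-pair value).

* `Consts.real_split_pair`, `Consts.setIntegral_split_pair` — pinning the pair `e` for events / integrands whose trace on `{e open}` is read
  off `ω ∖ {e}`;  `Consts.covD_split_pair` — the resulting decomposition of `covD w x Y f u` along the state of `e`:
  `covD = (q d₁ + (1−q) d₀)(q I₁ + (1−q) I₀) − (q J₁ + (1−q) J₀)(q m₁ + (1−q) m₀)` (`q = w_e`; the `1`-quantities are `μ₀`-integrals over
  `D₁` of `f` evaluated on the cluster of `x` WITH `e` inserted, the `0`-quantities are the `μ₀`-constituents of `covD w₀ x Y f u`).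
* `Consts.mdlx_of_pairDeleted` — **THEOREM (single-edge reduction).**  If `λ` is admissible for the pair-deleted weights `w₀` and
  `λ ≤ p⋆` (denominator-free, in the data of `w₀`: `λ · μ₀(D₁) μ₀(D ∩ {x ↮ v}) ≤ μ₀(D) μ₀(D₁ ∩ {o ∈ C_x ∪ C_v}) − μ₀(D₁) μ₀(D ∩ {x ↔ o})`),
  then `λ` is admissible for `w` (non-degenerate weights).  With `Consts.singleEdge_not_improvable`: the sharp observer constant satisfies
  `min(p⋆, p_hi(G − e)) ≤ p_hi(G) ≤ p⋆`; in particular "single-edge extremality" (`p_hi = p⋆`, prim-paper-s3 F7, census 2 772/2 772) is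
  EQUIVALENT to the admissibility of `p⋆` on graphs in which `x` and `v` are not joined.
  Proof: in the decomposition, the `q²`-part is `covD` for the weights with `e` forced open, nonnegative by van den Berg–Häggström–Kahn
  Thm 1.3 (`Consts.covD_conn_nonneg`); the `(1−q)²`-part is the `w₀`-margin; the cross term equals, after multiplying by `μ₀(D) μ₀(D₁)`,
  `μ₀(D)² · (q²-part) + μ₀(D₁)² · (w₀-margin) + (μ₀(D) J₁ − μ₀(D₁) J₀) · (p⋆-slack)`, and `μ₀(D) J₁ ≥ μ₀(D₁) J₀` is monotonicity of `f` plus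
  Thm 1.4 with sets (`1{v ↔ Y}` read on the cluster of `Y` is negatively correlated with `f(𝐂_x)` given `x ↮ Y`).
[cite: VandenbergHaggstromKahn2005, Thm. 1.3 (p. 6), Thm. 1.4 (p. 7) with Remark 1 after Thm. 1.2 (p. 5)]
-/

noncomputable section

namespace Summit.CriticalPhenomena.PercolationContinuityZ3.Theorems

open MeasureTheory Set Literature.Probability.LatticeModels Literature.Probability.Percolation
open scoped Classical

namespace Consts

variable {V : Type*} [Fintype V]

omit [Fintype V] in
/-- With the pair `e = s(x,v)` open, `x ↮ Y` iff `x ↮ Y` and `v ↮ Y` after deleting `e` (= `Consts.avoid_iff_sdiff_pair` of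
`…ConstsSingleEdgeValue`; private copy so that this file does not wait for that module's farm build). [folklore] -/
private theorem avoid_iff_sdiff_pair_aux {ω : BondConfig V} {x v : V} (Y : Set V) (he : s(x, v) ∈ ω) :
    (∀ y ∈ Y, ¬ (openGraph ω).Reachable x y) ↔
      ∀ y ∈ Y, ¬ (openGraph (ω \ {s(x, v)})).Reachable x y ∧ ¬ (openGraph (ω \ {s(x, v)})).Reachable v y := by
  constructor
  · intro h y hy
    have h' := h y hy
    rw [CSH.reachable_iff_sdiff_pair y he] at h'
    exact ⟨fun h1 => h' (Or.inl h1), fun h2 => h' (Or.inr h2)⟩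
  · intro h y hy hr
    rw [CSH.reachable_iff_sdiff_pair y he] at hr
    exact hr.elim (h y hy).1 (h y hy).2

/-- `cov_D(f; x ↔ u) ≥ 0` for monotone `f` and `x ∉ Y` (van den Berg–Häggström–Kahn Thm 1.3; = `Consts.covD_conn_nonneg` of
`…ConstsMDLXJointImpliesMDLX`, private copy for the same reason). [cite: VandenbergHaggstromKahn2005, Thm. 1.3 (p. 6)] -/
private theorem covD_conn_nonneg_aux (w : Sym2 V → unitInterval) (x : V) (Y : Set V) (hx : x ∉ Y) (f : Set (Sym2 V) → ℝ)
    (hf : Monotone f) (u : V) : 0 ≤ CSH.covD w x Y f u := by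
  set μ := prodBernoulli w with hμ
  set D : Set (BondConfig V) := {ω | ∀ y ∈ Y, ¬ (openGraph ω).Reachable x y} with hD
  have key := BHK2006_clusterConditionalPositiveAssociation_holds V w x Y f (connIndicatorFn x u) hf
    (monotone_connIndicatorFn x u) hx
  have h1 : ∫ ω in D, connIndicatorFn x u (openEdgeCluster ω x) ∂μ = μ.real (D ∩ openConn x u) := by
    simp_rw [connIndicatorFn_openEdgeCluster]
    exact KNPreFKG.setIntegral_indicator_one_eq μ D _
  have h2 : ∫ ω in D, f (openEdgeCluster ω x) * connIndicatorFn x u (openEdgeCluster ω x) ∂μ =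
      ∫ ω in D ∩ openConn x u, f (openEdgeCluster ω x) ∂μ := by
    simp_rw [connIndicatorFn_openEdgeCluster]
    have hfun : (fun ω : BondConfig V => f (openEdgeCluster ω x) * (openConn x u : Set (BondConfig V)).indicator 1 ω) =
        (openConn x u : Set (BondConfig V)).indicator (fun ω => f (openEdgeCluster ω x)) := by
      funext ω
      rw [← Set.indicator_mul_right (openConn x u) (fun ω => f (openEdgeCluster ω x)) (1 : BondConfig V → ℝ)]
      simp only [Pi.one_apply, mul_one]
    rw [hfun, setIntegral_indicator (MeasurableSet.of_discrete)]
  rw [h1, h2] at key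
  show 0 ≤ μ.real D * (∫ ω in D ∩ openConn x u, f (openEdgeCluster ω x) ∂μ) -
      (∫ ω in D, f (openEdgeCluster ω x) ∂μ) * μ.real (D ∩ openConn x u)
  linarith

/-- **Pinning a pair, events.**  If on `{e ∈ ω}` membership in `S` is read off `ω ∖ {e}` as membership in `T`, then
`μ(S) = w_e · μ₀(T) + (1 − w_e) · μ₀(S)` (`μ₀` = the law with `e` switched off). [folklore] -/
theorem real_split_pair (w : Sym2 V → unitInterval) (e : Sym2 V) (S T : Set (BondConfig V))
    (hST : ∀ ω : BondConfig V, e ∈ ω → (ω ∈ S ↔ ω \ {e} ∈ T)) :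
    (prodBernoulli w).real S =
      (w e : ℝ) * (prodBernoulli fun d => if d = e then 0 else w d).real T +
        (1 - (w e : ℝ)) * (prodBernoulli fun d => if d = e then 0 else w d).real S := by
  classical
  have hmeas : ∀ U : Set (BondConfig V), MeasurableSet U := fun _ => MeasurableSet.of_discrete
  rw [← integral_indicator_one (hmeas S), ← integral_indicator_one (hmeas S), ← integral_indicator_one (hmeas T)]
  have hpt : ∀ ω : BondConfig V, S.indicator (1 : BondConfig V → ℝ) ω =
      (if e ∈ ω then (1 : ℝ) else 0) * T.indicator (1 : BondConfig V → ℝ) (ω \ {e}) +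
        (if e ∈ ω then (0 : ℝ) else 1) * S.indicator (1 : BondConfig V → ℝ) ω := by
    intro ω
    by_cases heω : e ∈ ω
    · by_cases hA : ω ∈ S
      · rw [indicator_of_mem hA, indicator_of_mem ((hST ω heω).1 hA), if_pos heω, if_pos heω, Pi.one_apply, Pi.one_apply]; ring
      · rw [indicator_of_notMem hA, indicator_of_notMem (fun h => hA ((hST ω heω).2 h))]; ring
    · rw [if_neg heω, if_neg heω]; ring
  have hint : ∫ ω, S.indicator (1 : BondConfig V → ℝ) ω ∂(prodBernoulli w) =
      ∫ ω, ((if e ∈ ω then (1 : ℝ) else 0) * T.indicator (1 : BondConfig V → ℝ) (ω \ {e}) +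
        (if e ∈ ω then (0 : ℝ) else 1) * S.indicator (1 : BondConfig V → ℝ) ω) ∂(prodBernoulli w) :=
    integral_congr_ae (Filter.Eventually.of_forall hpt)
  rw [hint, integral_add (Integrable.of_finite) (Integrable.of_finite), CSH.integral_indicator_mem_mul_comp_sdiff,
    CSH.integral_indicator_not_mem_mul]

/-- **Pinning a pair, integrands.**  Under the same hypothesis, for any `g`:
`∫_S g dμ = w_e · ∫_T g(insert e ·) dμ₀ + (1 − w_e) · ∫_S g dμ₀`. [folklore] -/
theorem setIntegral_split_pair (w : Sym2 V → unitInterval) (e : Sym2 V) (S T : Set (BondConfig V))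
    (hST : ∀ ω : BondConfig V, e ∈ ω → (ω ∈ S ↔ ω \ {e} ∈ T)) (g : BondConfig V → ℝ) :
    ∫ ω in S, g ω ∂(prodBernoulli w) =
      (w e : ℝ) * ∫ ω in T, g (insert e ω) ∂(prodBernoulli fun d => if d = e then 0 else w d) +
        (1 - (w e : ℝ)) * ∫ ω in S, g ω ∂(prodBernoulli fun d => if d = e then 0 else w d) := by
  classical
  have hmeas : ∀ U : Set (BondConfig V), MeasurableSet U := fun _ => MeasurableSet.of_discrete
  rw [← integral_indicator (hmeas S), ← integral_indicator (hmeas S), ← integral_indicator (hmeas T)]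
  have hpt : ∀ ω : BondConfig V, S.indicator g ω =
      (if e ∈ ω then (1 : ℝ) else 0) * T.indicator (fun η => g (insert e η)) (ω \ {e}) +
        (if e ∈ ω then (0 : ℝ) else 1) * S.indicator g ω := by
    intro ω
    by_cases heω : e ∈ ω
    · have hins : insert e (ω \ {e}) = ω := by rw [Set.insert_sdiff_singleton, Set.insert_eq_of_mem heω]
      by_cases hA : ω ∈ S
      · rw [indicator_of_mem hA, indicator_of_mem ((hST ω heω).1 hA), hins, if_pos heω, if_pos heω]; ring
      · rw [indicator_of_notMem hA, indicator_of_notMem (fun h => hA ((hST ω heω).2 h))]; ring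
    · rw [if_neg heω, if_neg heω]; ring
  have hint : ∫ ω, S.indicator g ω ∂(prodBernoulli w) =
      ∫ ω, ((if e ∈ ω then (1 : ℝ) else 0) * T.indicator (fun η => g (insert e η)) (ω \ {e}) +
        (if e ∈ ω then (0 : ℝ) else 1) * S.indicator g ω) ∂(prodBernoulli w) :=
    integral_congr_ae (Filter.Eventually.of_forall hpt)
  rw [hint, integral_add (Integrable.of_finite) (Integrable.of_finite), CSH.integral_indicator_mem_mul_comp_sdiff,
    CSH.integral_indicator_not_mem_mul]

/-- **Decomposition of `covD w x Y f u` along the state of the pair `e = s(x,v)`** (`x ≠ v`, any `f`, any weights).  With `q = w_e`,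
`μ₀` the law with `e` off, `D = {x ↮ Y}`, `D₁ = {x ↮ Y} ∩ {v ↮ Y}`, `B_u = {x ↔ u} ∪ {v ↔ u}`, `f⁺(η) = f(𝐂_x(insert e η))`:
`covD = (q μ₀(D₁) + (1−q) μ₀(D)) (q ∫_{D₁∩B_u} f⁺ + (1−q) ∫_{D∩{x↔u}} f) − (q ∫_{D₁} f⁺ + (1−q) ∫_D f) (q μ₀(D₁∩B_u) + (1−q) μ₀(D∩{x↔u}))`
(all integrals `dμ₀`, `f` read on `𝐂_x`). [folklore] -/
theorem covD_split_pair (w : Sym2 V → unitInterval) (x v u : V) (Y : Set V) (f : Set (Sym2 V) → ℝ) :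
    CSH.covD w x Y f u =
      ((w s(x, v) : ℝ) *
            (prodBernoulli fun d => if d = s(x, v) then 0 else w d).real
              {ω : BondConfig V | ∀ y ∈ Y, ¬ (openGraph ω).Reachable x y ∧ ¬ (openGraph ω).Reachable v y} +
          (1 - (w s(x, v) : ℝ)) *
            (prodBernoulli fun d => if d = s(x, v) then 0 else w d).real
              {ω : BondConfig V | ∀ y ∈ Y, ¬ (openGraph ω).Reachable x y}) *
        ((w s(x, v) : ℝ) *
            (∫ ω in {ω : BondConfig V | ∀ y ∈ Y, ¬ (openGraph ω).Reachable x y ∧ ¬ (openGraph ω).Reachable v y} ∩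
                (openConn x u ∪ openConn v u),
              f (openEdgeCluster (insert s(x, v) ω) x) ∂(prodBernoulli fun d => if d = s(x, v) then 0 else w d)) +
          (1 - (w s(x, v) : ℝ)) *
            (∫ ω in {ω : BondConfig V | ∀ y ∈ Y, ¬ (openGraph ω).Reachable x y} ∩ openConn x u,
              f (openEdgeCluster ω x) ∂(prodBernoulli fun d => if d = s(x, v) then 0 else w d))) -
      ((w s(x, v) : ℝ) *
            (∫ ω in {ω : BondConfig V | ∀ y ∈ Y, ¬ (openGraph ω).Reachable x y ∧ ¬ (openGraph ω).Reachable v y},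
              f (openEdgeCluster (insert s(x, v) ω) x) ∂(prodBernoulli fun d => if d = s(x, v) then 0 else w d)) +
          (1 - (w s(x, v) : ℝ)) *
            (∫ ω in {ω : BondConfig V | ∀ y ∈ Y, ¬ (openGraph ω).Reachable x y},
              f (openEdgeCluster ω x) ∂(prodBernoulli fun d => if d = s(x, v) then 0 else w d))) *
        ((w s(x, v) : ℝ) *
            (prodBernoulli fun d => if d = s(x, v) then 0 else w d).real
              ({ω : BondConfig V | ∀ y ∈ Y, ¬ (openGraph ω).Reachable x y ∧ ¬ (openGraph ω).Reachable v y} ∩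
                (openConn x u ∪ openConn v u)) +
          (1 - (w s(x, v) : ℝ)) *
            (prodBernoulli fun d => if d = s(x, v) then 0 else w d).real
              ({ω : BondConfig V | ∀ y ∈ Y, ¬ (openGraph ω).Reachable x y} ∩ openConn x u)) := by
  classical
  set e : Sym2 V := s(x, v) with he_def
  set D : Set (BondConfig V) := {ω | ∀ y ∈ Y, ¬ (openGraph ω).Reachable x y} with hD
  set D₁ : Set (BondConfig V) := {ω | ∀ y ∈ Y, ¬ (openGraph ω).Reachable x y ∧ ¬ (openGraph ω).Reachable v y} with hD₁
  have hDiff : ∀ ω : BondConfig V, e ∈ ω → (ω ∈ D ↔ ω \ {e} ∈ D₁) := fun ω heω => avoid_iff_sdiff_pair_aux Y heω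
  have hDAiff : ∀ ω : BondConfig V, e ∈ ω → (ω ∈ D ∩ openConn x u ↔ ω \ {e} ∈ D₁ ∩ (openConn x u ∪ openConn v u)) := by
    intro ω heω
    rw [mem_inter_iff, mem_inter_iff, hDiff ω heω]
    have : ω ∈ openConn x u ↔ ω \ {e} ∈ openConn x u ∪ openConn v u := by
      show (openGraph ω).Reachable x u ↔ _
      rw [CSH.reachable_iff_sdiff_pair u heω]; rfl
    rw [this]
  unfold CSH.covD
  rw [real_split_pair w e D D₁ hDiff, real_split_pair w e _ _ hDAiff,
    setIntegral_split_pair w e D D₁ hDiff (fun ω => f (openEdgeCluster ω x)),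
    setIntegral_split_pair w e _ _ hDAiff (fun ω => f (openEdgeCluster ω x))]

/-- **THEOREM (single-edge reduction for the observer constant of MDL(X)).**  Non-degenerate weights `w`, owner `x ∉ Y`, observers `o`
and `v ∉ Y`; `w₀` = `w` with the pair `s(x,v)` switched off, `μ₀ = prodBernoulli w₀`, `D = {x ↮ Y}`, `D₁ = {x ↮ Y} ∩ {v ↮ Y}`.
If a constant `λ` (i) is admissible for `w₀` — `covD w₀ x Y f o − λ · covD w₀ x Y f v ≥ 0` for every monotone `f` — and (ii) is at most the
single-pair value `p⋆` — denominator-free `λ · μ₀(D₁) μ₀(D ∩ {x ↮ v}) ≤ μ₀(D) μ₀(D₁ ∩ ({x ↔ o} ∪ {v ↔ o})) − μ₀(D₁) μ₀(D ∩ {x ↔ o})` —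
then `λ` is admissible for `w`: `covD w x Y f o − λ · covD w x Y f v ≥ 0` for every monotone `f`.
Hence `min(p⋆, p_hi(G − e)) ≤ p_hi(G) ≤ p⋆` for the sharp observer constant (`Consts.singleEdge_not_improvable` for the upper bound).
[cite: VandenbergHaggstromKahn2005, Thm. 1.3 (p. 6), Thm. 1.4 (p. 7) with Remark 1 after Thm. 1.2 (p. 5)] -/
theorem mdlx_of_pairDeleted (w : Sym2 V → unitInterval) (hw : ∀ d, 0 < w d ∧ w d < 1) (x o v : V) (Y : Set V)
    (hx : x ∉ Y) (hv : v ∉ Y) (lam : ℝ)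
    (hlam : lam * ((prodBernoulli fun d => if d = s(x, v) then 0 else w d).real
              {ω : BondConfig V | ∀ y ∈ Y, ¬ (openGraph ω).Reachable x y ∧ ¬ (openGraph ω).Reachable v y} *
            (prodBernoulli fun d => if d = s(x, v) then 0 else w d).real
              ({ω : BondConfig V | ∀ y ∈ Y, ¬ (openGraph ω).Reachable x y} ∩ {ω | ¬ (openGraph ω).Reachable x v})) ≤
      (prodBernoulli fun d => if d = s(x, v) then 0 else w d).real {ω : BondConfig V | ∀ y ∈ Y, ¬ (openGraph ω).Reachable x y} *
          (prodBernoulli fun d => if d = s(x, v) then 0 else w d).real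
            ({ω : BondConfig V | ∀ y ∈ Y, ¬ (openGraph ω).Reachable x y ∧ ¬ (openGraph ω).Reachable v y} ∩
              (openConn x o ∪ openConn v o)) -
        (prodBernoulli fun d => if d = s(x, v) then 0 else w d).real
            {ω : BondConfig V | ∀ y ∈ Y, ¬ (openGraph ω).Reachable x y ∧ ¬ (openGraph ω).Reachable v y} *
          (prodBernoulli fun d => if d = s(x, v) then 0 else w d).real
            ({ω : BondConfig V | ∀ y ∈ Y, ¬ (openGraph ω).Reachable x y} ∩ openConn x o))
    (h0 : ∀ f : Set (Sym2 V) → ℝ, Monotone f →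
      0 ≤ CSH.covD (fun d => if d = s(x, v) then 0 else w d) x Y f o -
        lam * CSH.covD (fun d => if d = s(x, v) then 0 else w d) x Y f v)
    (f : Set (Sym2 V) → ℝ) (hf : Monotone f) :
    0 ≤ CSH.covD w x Y f o - lam * CSH.covD w x Y f v := by
  classical
  have hmeas : ∀ U : Set (BondConfig V), MeasurableSet U := fun _ => MeasurableSet.of_discrete
  -- the weights with the pair forced open, and the three laws
  set w₁ : Sym2 V → unitInterval := fun d => if d = s(x, v) then 1 else w d with hw₁
  have hw10 : (fun d => if d = s(x, v) then (0 : unitInterval) else w₁ d) = fun d => if d = s(x, v) then 0 else w d := by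
    funext d
    by_cases h : d = s(x, v)
    · rw [if_pos h, if_pos h]
    · rw [if_neg h, if_neg h, hw₁]; dsimp only; rw [if_neg h]
  have hw1e : ((w₁ s(x, v) : unitInterval) : ℝ) = 1 := by
    rw [hw₁]; dsimp only; rw [if_pos rfl]; rfl
  -- the three decompositions
  have Ho := covD_split_pair w x v o Y f
  have Hv := covD_split_pair w x v v Y f
  have H1 := covD_split_pair w₁ x v o Y f
  rw [hw10, hw1e] at H1
  have hB : (openConn x v ∪ openConn v v : Set (BondConfig V)) = Set.univ := by
    ext ω; simp only [Set.mem_union, Set.mem_univ, iff_true]; exact Or.inr (SimpleGraph.Reachable.refl _)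
  rw [hB, Set.inter_univ] at Hv
  -- the `e`-forced-open covariance is nonnegative (vdBHK Thm 1.3)
  have C1 := covD_conn_nonneg_aux w₁ x Y hx f hf o
  rw [H1] at C1
  -- the pair-deleted margin
  have M0 := h0 f hf
  unfold CSH.covD at M0
  rw [Ho, Hv]
  -- name the constituents
  set μ₀ := prodBernoulli (fun d => if d = s(x, v) then 0 else w d) with hμ₀
  set D : Set (BondConfig V) := {ω | ∀ y ∈ Y, ¬ (openGraph ω).Reachable x y} with hD
  set D₁ : Set (BondConfig V) := {ω | ∀ y ∈ Y, ¬ (openGraph ω).Reachable x y ∧ ¬ (openGraph ω).Reachable v y} with hD₁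
  set q : ℝ := (w s(x, v) : ℝ) with hq
  set d₀ : ℝ := μ₀.real D with hd₀
  set d₁ : ℝ := μ₀.real D₁ with hd₁
  set m1o : ℝ := μ₀.real (D₁ ∩ (openConn x o ∪ openConn v o)) with hm1o
  set m0o : ℝ := μ₀.real (D ∩ openConn x o) with hm0o
  set m0v : ℝ := μ₀.real (D ∩ openConn x v) with hm0v
  set n0 : ℝ := μ₀.real (D ∩ {ω | ¬ (openGraph ω).Reachable x v}) with hn0
  set J1 : ℝ := ∫ ω in D₁, f (openEdgeCluster (insert s(x, v) ω) x) ∂μ₀ with hJ1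
  set J0 : ℝ := ∫ ω in D, f (openEdgeCluster ω x) ∂μ₀ with hJ0
  set I1o : ℝ := ∫ ω in D₁ ∩ (openConn x o ∪ openConn v o), f (openEdgeCluster (insert s(x, v) ω) x) ∂μ₀ with hI1o
  set I0o : ℝ := ∫ ω in D ∩ openConn x o, f (openEdgeCluster ω x) ∂μ₀ with hI0o
  set I0v : ℝ := ∫ ω in D ∩ openConn x v, f (openEdgeCluster ω x) ∂μ₀ with hI0v
  -- (a) the `e`-forced-open part
  have c1 : 0 ≤ d₁ * I1o - J1 * m1o := by
    have h := C1
    simp only [one_mul, sub_self, zero_mul, add_zero] at h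
    linarith
  -- (b) signs and ranges
  have hq0 : 0 ≤ q := (w s(x, v)).2.1
  have hq1 : q ≤ 1 := (w s(x, v)).2.2
  have hlt : ∀ d, (if d = s(x, v) then (0 : unitInterval) else w d) < 1 := fun d => by
    split_ifs
    exacts [zero_lt_one, (hw d).2]
  have hbot : openGraph (∅ : BondConfig V) = ⊥ := by
    unfold openGraph; exact SimpleGraph.fromEdgeSet_empty
  have hnoreach : ∀ a b : V, a ≠ b → ¬ (openGraph (∅ : BondConfig V)).Reachable a b := fun a b hab h => by
    rw [hbot, SimpleGraph.reachable_bot] at h; exact hab h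
  have hd0 : 0 < d₀ :=
    CSH.prodBernoulli_real_pos_of_empty_mem _ hlt (fun y hy => hnoreach x y (fun h => hx (h ▸ hy)))
  have hd1 : 0 < d₁ :=
    CSH.prodBernoulli_real_pos_of_empty_mem _ hlt (fun y hy =>
      ⟨hnoreach x y (fun h => hx (h ▸ hy)), hnoreach v y (fun h => hv (h ▸ hy))⟩)
  -- (c) `n0 = d₀ − m0v`
  have hn0' : m0v + n0 = d₀ := by
    have h := measureReal_inter_add_sdiff (μ := μ₀) (s := D) (hmeas (openConn x v))
    have hset : D \ openConn x v = D ∩ {ω | ¬ (openGraph ω).Reachable x v} := by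
      ext ω; simp only [mem_sdiff, mem_inter_iff, mem_setOf_eq]; rfl
    rw [hset] at h
    exact h
  -- (d) `d₀ J1 ≥ d₁ J0`: monotonicity of `f` and Thm 1.4 with sets for `f(𝐂_x)` and `1{v ↔ Y}` given `x ↮ Y`
  have hJ : d₁ * J0 ≤ d₀ * J1 := by
    -- `J1 ≥ ∫_{D₁} f(𝐂_x) dμ₀`
    have hmono : ∫ ω in D₁, f (openEdgeCluster ω x) ∂μ₀ ≤ J1 := by
      refine setIntegral_mono_on (Integrable.of_finite).integrableOn (Integrable.of_finite).integrableOn (hmeas _) ?_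
      intro ω _
      exact hf (BHK2006.openEdgeCluster_mono (Set.subset_insert _ _) x)
    -- two-set negative correlation
    set G : Set (Sym2 V) → ℝ := fun C => if (∃ y ∈ Y, (openGraph C).Reachable y v) then (1 : ℝ) else 0 with hG
    have hGm : Monotone G := by
      refine TripodExchange.predIndicator_monotone ?_
      rintro C C' hCC' ⟨y, hy, hr⟩
      exact ⟨y, hy, hr.mono (openGraph_mono hCC')⟩
    have h𝒜 : {ω : BondConfig V | ∀ a ∈ ({x} : Set V), ∀ t ∈ Y, ¬ (openGraph ω).Reachable a t} = D := by
      ext ω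
      simp only [hD, mem_setOf_eq, mem_singleton_iff, forall_eq]
    have hFω : ∀ ω : BondConfig V, f (⋃ a ∈ ({x} : Set V), openEdgeCluster ω a) = f (openEdgeCluster ω x) := by
      intro ω
      have : (⋃ a ∈ ({x} : Set V), openEdgeCluster ω a) = openEdgeCluster ω x := by ext d; simp
      rw [this]
    set W : Set (BondConfig V) := {ω | ∃ y ∈ Y, (openGraph ω).Reachable y v} with hW
    have hGω : ∀ ω : BondConfig V, G (⋃ t ∈ Y, openEdgeCluster ω t) = W.indicator 1 ω := by
      intro ω
      have hiff : (∃ y ∈ Y, (openGraph (⋃ t ∈ Y, openEdgeCluster ω t)).Reachable y v) ↔ ∃ y ∈ Y, (openGraph ω).Reachable y v := by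
        constructor
        · rintro ⟨y, hy, hr⟩
          exact ⟨y, hy, (KNSep.reachable_iff_cluster ω Y hy v).2 hr⟩
        · rintro ⟨y, hy, hr⟩
          exact ⟨y, hy, (KNSep.reachable_iff_cluster ω Y hy v).1 hr⟩
      simp only [hG, hiff]
      exact TwoSetConditionalAssociation.predIndicator_eq_indicator (fun ω' => ∃ y ∈ Y, (openGraph ω').Reachable y v) ω
    have key := BHK2006_twoSetConditionalAssociation.negCorrelation (fun d => if d = s(x, v) then 0 else w d) {x} Y f G hf hGm
    simp only [h𝒜, hFω, hGω] at key
    -- read the indicator integrals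
    have e1 : ∫ ω in D, W.indicator (1 : BondConfig V → ℝ) ω ∂μ₀ = μ₀.real (D ∩ W) := KNPreFKG.setIntegral_indicator_one_eq μ₀ D W
    have e2 : ∫ ω in D, f (openEdgeCluster ω x) * W.indicator (1 : BondConfig V → ℝ) ω ∂μ₀ =
        ∫ ω in D ∩ W, f (openEdgeCluster ω x) ∂μ₀ := by
      have hfun : (fun ω : BondConfig V => f (openEdgeCluster ω x) * W.indicator (1 : BondConfig V → ℝ) ω) =
          W.indicator (fun ω => f (openEdgeCluster ω x)) := by
        funext ω
        rw [← Set.indicator_mul_right W (fun ω => f (openEdgeCluster ω x)) (1 : BondConfig V → ℝ)]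
        simp only [Pi.one_apply, mul_one]
      rw [hfun, setIntegral_indicator (hmeas W)]
    rw [e1, e2] at key
    -- `D = D₁ ⊔ (D ∩ W)`
    have hDW : D \ W = D₁ := by
      ext ω
      simp only [hD, hD₁, hW, mem_sdiff, mem_setOf_eq, not_exists, not_and]
      constructor
      · rintro ⟨h1, h2⟩ y hy
        exact ⟨h1 y hy, fun hr => h2 y hy hr.symm⟩
      · intro h
        exact ⟨fun y hy => (h y hy).1, fun y hy hr => (h y hy).2 hr.symm⟩
    have iD : (∫ ω in D ∩ W, f (openEdgeCluster ω x) ∂μ₀) + ∫ ω in D₁, f (openEdgeCluster ω x) ∂μ₀ = J0 := by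
      have h := integral_inter_add_sdiff (μ := μ₀) (f := fun ω => f (openEdgeCluster ω x)) (hmeas W)
        ((Integrable.of_finite).integrableOn (s := D))
      rw [hDW] at h
      exact h
    have mD : μ₀.real (D ∩ W) + d₁ = d₀ := by
      have h := measureReal_inter_add_sdiff (μ := μ₀) (s := D) (hmeas W)
      rw [hDW] at h
      exact h
    -- key : d₀ * ∫_{D∩W} f ≤ J0 * μ₀(D ∩ W)
    have h1 : d₀ * (∫ ω in D ∩ W, f (openEdgeCluster ω x) ∂μ₀) ≤ J0 * μ₀.real (D ∩ W) := key
    have hX : (∫ ω in D ∩ W, f (openEdgeCluster ω x) ∂μ₀) = J0 - ∫ ω in D₁, f (openEdgeCluster ω x) ∂μ₀ := by linarith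
    have hMW : μ₀.real (D ∩ W) = d₀ - d₁ := by linarith
    rw [hX, hMW] at h1
    have h2 : d₁ * J0 ≤ d₀ * ∫ ω in D₁, f (openEdgeCluster ω x) ∂μ₀ := by nlinarith [h1]
    exact h2.trans (mul_le_mul_of_nonneg_left hmono hd0.le)
  -- (e) the algebra: multiply the goal by `d₀ d₁ > 0`
  have hR : 0 ≤ d₀ * m1o - d₁ * m0o - lam * (d₁ * n0) := by linarith
  have hJ' : 0 ≤ d₀ * J1 - d₁ * J0 := by linarith
  have hid : d₀ * d₁ *
      ((q * d₁ + (1 - q) * d₀) * (q * I1o + (1 - q) * I0o) - (q * J1 + (1 - q) * J0) * (q * m1o + (1 - q) * m0o) -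
        lam * ((q * d₁ + (1 - q) * d₀) * (q * J1 + (1 - q) * I0v) - (q * J1 + (1 - q) * J0) * (q * d₁ + (1 - q) * m0v))) =
      d₀ * d₁ * (q ^ 2 * (d₁ * I1o - J1 * m1o) + (1 - q) ^ 2 * (d₀ * I0o - J0 * m0o - lam * (d₀ * I0v - J0 * m0v))) +
        q * (1 - q) * (d₀ ^ 2 * (d₁ * I1o - J1 * m1o) + d₁ ^ 2 * (d₀ * I0o - J0 * m0o - lam * (d₀ * I0v - J0 * m0v)) +
          (d₀ * J1 - d₁ * J0) * (d₀ * m1o - d₁ * m0o - lam * (d₁ * n0))) := by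
    have hm0v : m0v = d₀ - n0 := by linarith
    rw [hm0v]
    ring
  have hM0 : 0 ≤ d₀ * I0o - J0 * m0o - lam * (d₀ * I0v - J0 * m0v) := by linarith
  have hrhs : 0 ≤ d₀ * d₁ * (q ^ 2 * (d₁ * I1o - J1 * m1o) + (1 - q) ^ 2 * (d₀ * I0o - J0 * m0o - lam * (d₀ * I0v - J0 * m0v))) +
      q * (1 - q) * (d₀ ^ 2 * (d₁ * I1o - J1 * m1o) + d₁ ^ 2 * (d₀ * I0o - J0 * m0o - lam * (d₀ * I0v - J0 * m0v)) +
        (d₀ * J1 - d₁ * J0) * (d₀ * m1o - d₁ * m0o - lam * (d₁ * n0))) := by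
    have h1q : 0 ≤ 1 - q := by linarith
    have t1 : 0 ≤ q ^ 2 * (d₁ * I1o - J1 * m1o) := mul_nonneg (sq_nonneg _) c1
    have t2 : 0 ≤ (1 - q) ^ 2 * (d₀ * I0o - J0 * m0o - lam * (d₀ * I0v - J0 * m0v)) := mul_nonneg (sq_nonneg _) hM0
    have t3 : 0 ≤ d₀ ^ 2 * (d₁ * I1o - J1 * m1o) := mul_nonneg (sq_nonneg _) c1
    have t4 : 0 ≤ d₁ ^ 2 * (d₀ * I0o - J0 * m0o - lam * (d₀ * I0v - J0 * m0v)) := mul_nonneg (sq_nonneg _) hM0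
    have t5 : 0 ≤ (d₀ * J1 - d₁ * J0) * (d₀ * m1o - d₁ * m0o - lam * (d₁ * n0)) := mul_nonneg hJ' hR
    have t6 := mul_nonneg (mul_nonneg hd0.le hd1.le) (add_nonneg t1 t2)
    have t7 := mul_nonneg (mul_nonneg hq0 h1q) (add_nonneg (add_nonneg t3 t4) t5)
    linarith
  rw [← hid] at hrhs
  by_contra hneg
  push Not at hneg
  have := mul_neg_of_pos_of_neg (mul_pos hd0 hd1) hneg
  linarith

end Consts

end Summit.CriticalPhenomena.PercolationContinuityZ3.Theorems

end
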